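import Summits.QuantumAdvantage.QuantumAdvantage.Theorems.CharDialCountDialC
import HarnessLib

/-!
# CharDial ▸ CountDial, part D — the Z-free support `SmallOrbitBlocks` and the lonely set: `FewLonelyTwoOdd`, the PRIMARY carving Leaf ⟸ EC ∧ SOB ∧ FL ∧ X, density zero of the lonely set

Part D of «CountDial» (NODE-g24.md §0, §4 «Z-free corollary», §7b of the node file): dropping LEMMA Z from `SmallOrbitYoung` leaves the
ELEMENTARY, PAPER-PROVED support ★ `SmallOrbitBlocks` (a cut with `≤ C^{m+1}` permutes has, off `E` with `k·#E ≤ m + K(C,k)`, its NON-LONELY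
coordinates in `≤ K` classes; proof = Lagrange + multinomial/Stirling bookkeeping) and isolates the LONELY SET as its own piece
★ `FewLonelyTwoOdd` (≤ N₀(p) coordinates exchangeable with nobody) — WEAKER than the leaf (`fewLonely_of_fewTypes`) AND weaker than g23's
located blocker `PartnersTwoOdd` (`fewLonely_of_partners`).  Junctions: ★ `almostFewTypes_of_expCount_blocks : EC → SOB → FL → AFT`,
★ `fewTypes_of_pieces' : EC → SOB → FL → X → Leaf`, ★ `structureLaw_of_pieces'`, ★ `pieces_of_structureLaw' : B → EC ∧ FL ∧ AFT ∧ X`, and the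
rung ★ `almostFewLonelyAt_of_almostFewTypesAt` (AFT ⟹ the lonely set has density zero).

Kernel standard: no placeholders; axioms [propext, Classical.choice, Quot.sound] only (guards at the end); closed computations by kernel `decide`.
-/

set_option autoImplicit false
set_option linter.dupNamespace false

namespace Summit.QuantumAdvantage.QuantumAdvantage.Theorems.CountDial

open Classical
open Finset
open Summit.QuantumAdvantage.AdviceFreeQNC0
open Literature.Computability.MetaComplexity Literature.Computability.MetaComplexity.Smolensky
open Summit.QuantumAdvantage.QuantumAdvantage.Theorems.TransferDial

/-! ## §7b The Z-free support `SmallOrbitBlocks` (paper-PROVED, elementary) and the LONELY SET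

The only non-elementary input of `SmallOrbitYoung` (LEMMA Z) serves to bound the number of LONELY coordinates (singleton classes).
Dropping it leaves an ELEMENTARY counting theorem (NODE-g24.md §4, (H2)–(H4) with Φ₁ := 1: no group theory beyond Lagrange, no Boolean
bootstrap): `SmallOrbitBlocks` — a cut with `≤ C^{m+1}` coordinate-permutes has, off an exceptional set `E` with `k·#E ≤ m + K(C,k)`, all its
NON-LONELY coordinates in `≤ K` exchangeability classes.  The lonely set is then carved out as its own piece `FewLonelyTwoOdd` — WEAKER than
the leaf AND weaker than g23's blocker `PartnersTwoOdd` (a lonely coordinate has no exchange partner): kernel junctions below. -/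

section Lonely
variable {p : ℕ} [hp : Fact p.Prime]

/-- A coordinate is LONELY for a cut when it is exchangeable with no other coordinate (its class is a singleton). -/
def Lonely {m : ℕ} (f : (Fin m → Bool) → Bool) (i : Fin m) : Prop := ∀ j : Fin m, j ≠ i → ¬ Sw f i j

/-- FEW LONELY coordinates at degree `d`: `#{i lonely} ≤ N₀`, uniformly in `m`. -/
def FewLonelyAt (p : ℕ) [Fact p.Prime] (d N₀ : ℕ) : Prop :=
  ∀ (m : ℕ) (f : (Fin m → Bool) → Bool), HasDegF p f d → (univ.filter fun i : Fin m => Lonely f i).card ≤ N₀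

/-- ★ PIECE `FewLonelyTwoOdd` (WEAKER than the leaf: `fewLonely_of_fewTypes`; weaker than g23's `PartnersTwoOdd`: `fewLonely_of_partners`;
OPEN; f58 shows `N₀(p) ≥ 9`): at degree `≤ 2p − 3` the number of lonely coordinates is bounded by `N₀(p)`. -/
def FewLonelyTwoOdd : Prop := ∀ (p : ℕ) [Fact p.Prime], 5 ≤ p → ∃ N₀ : ℕ, FewLonelyAt p (2 * p - 3) N₀

/-- Partners ⟹ few lonely (a lonely coordinate has `0 < 3p − 2` partners, so it lies in the exceptional set). -/
theorem fewLonelyAt_of_partnersAt {d N₀ : ℕ} (h : PartnersAt p d N₀) : FewLonelyAt p d N₀ := by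
  intro m f hf
  obtain ⟨L, hL, hP⟩ := h m f hf
  refine le_trans (card_le_card ?_) hL
  intro i hi
  rw [mem_filter] at hi
  by_contra hiL
  have h1 := hP i hiL
  have h0 : (univ.filter fun j : Fin m => j ≠ i ∧ Sw f i j).card = 0 := by
    rw [Finset.card_eq_zero, Finset.filter_eq_empty_iff]
    intro j _ hj
    exact hi.2 j hj.1 hj.2
  rw [h0] at h1
  have h2 := hp.out.two_le
  omega

/-- `PartnersTwoOdd` ⟹ `FewLonelyTwoOdd` (kernel): FL is weaker than g23's blocker. -/
theorem fewLonely_of_partners (h : PartnersTwoOdd) : FewLonelyTwoOdd := by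
  intro p _ hp5
  obtain ⟨N₀, hN⟩ := h p hp5
  exact ⟨N₀, fewLonelyAt_of_partnersAt hN⟩

/-- ★ Leaf ⟹ few lonely (kernel, through the tree's `partners_of_fewTypes`). -/
theorem fewLonely_of_fewTypes (h : FewTypesTwoOdd) : FewLonelyTwoOdd := fewLonely_of_partners (partners_of_fewTypes h)

/-- ALMOST-FEW OFF THE LONELY SET: exceptional set `E` with `k·#E ≤ m + K`, `K` colours, «same colour, both non-lonely, off `E` ⟹ exchangeable». -/
def AlmostFewL {m : ℕ} (f : (Fin m → Bool) → Bool) (k K : ℕ) : Prop :=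
  ∃ E : Finset (Fin m), k * E.card ≤ m + K ∧ ∃ c : Fin m → Fin K,
    ∀ i ∉ E, ∀ j ∉ E, ¬ Lonely f i → ¬ Lonely f j → c i = c j → Sw f i j

/-- ★ PIECE SOB — `SmallOrbitBlocks` (support; PAPER-PROVED, elementary, NODE-g24.md §4 with Φ₁ := 1 — no LEMMA Z, no Boolean bootstrap):
a cut with `≤ C^{m+1}` coordinate-permutes is, for every `k`, almost-few off its lonely set with `K = K(C,k)` uniformly in `m`. -/
def SmallOrbitBlocks : Prop :=
  ∀ C k : ℕ, ∃ K : ℕ, ∀ (m : ℕ) (f : (Fin m → Bool) → Bool), (orbitS f).card ≤ C ^ (m + 1) → AlmostFewL f k K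

/-- `AlmostFew` ⟹ `AlmostFewL` (forget the constraint on lonely pairs). -/
theorem almostFewL_of_almostFew {m : ℕ} {f : (Fin m → Bool) → Bool} {k K : ℕ} (h : AlmostFew f k K) : AlmostFewL f k K := by
  obtain ⟨E, hE, c, hc⟩ := h
  exact ⟨E, hE, c, fun i hi j hj _ _ hij => hc i hi j hj hij⟩

/-- SOY ⟹ SOB (kernel): the Z-free support is the weaker one. -/
theorem smallOrbitBlocks_of_smallOrbitYoung (h : SmallOrbitYoung) : SmallOrbitBlocks := by
  intro C k
  obtain ⟨K, hK⟩ := h C k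
  refine ⟨K, fun m f hf => ?_⟩
  obtain ⟨E, hE, c, hcyc, h3⟩ := hK m f hf
  exact ⟨E, hE, c, fun i hi j hj _ _ hij => sw_of_cycInv f E c hcyc h3 i hi j hj hij⟩

/-- ★ AlmostFewL ∧ (few lonely) ⟹ AlmostFew (kernel): move the lonely coordinates into the exceptional set. -/
theorem almostFew_of_almostFewL {m : ℕ} {f : (Fin m → Bool) → Bool} {k K N₀ : ℕ} (h : AlmostFewL f k K)
    (hL : (univ.filter fun i : Fin m => Lonely f i).card ≤ N₀) : AlmostFew f k (K + k * N₀) := by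
  obtain ⟨E, hE, c, hc⟩ := h
  refine ⟨E ∪ univ.filter (fun i : Fin m => Lonely f i), ?_, fun i => Fin.castLE (Nat.le_add_right K (k * N₀)) (c i), ?_⟩
  · have h1 : (E ∪ univ.filter (fun i : Fin m => Lonely f i)).card ≤ E.card + (univ.filter fun i : Fin m => Lonely f i).card :=
      card_union_le _ _
    have h2 : k * (E ∪ univ.filter (fun i : Fin m => Lonely f i)).card ≤ k * E.card + k * N₀ := by
      calc k * (E ∪ univ.filter (fun i : Fin m => Lonely f i)).card
          ≤ k * (E.card + (univ.filter fun i : Fin m => Lonely f i).card) := Nat.mul_le_mul_left _ h1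
        _ = k * E.card + k * (univ.filter fun i : Fin m => Lonely f i).card := by ring
        _ ≤ k * E.card + k * N₀ := by have := Nat.mul_le_mul_left k hL; omega
    omega
  · intro i hi j hj hij
    rw [mem_union, not_or, mem_filter] at hi hj
    have hci : c i = c j := by
      have := congrArg Fin.val hij
      exact Fin.ext (by simpa using this)
    exact hc i hi.1 j hj.1 (fun h => hi.2 ⟨mem_univ _, h⟩) (fun h => hj.2 ⟨mem_univ _, h⟩) hci

/-- ★ ORBIT BOUND ∧ SOB ∧ FEW LONELY ⟹ ALMOST-FEW-TYPES (kernel, pointwise in the degree). -/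
theorem almostFewTypesAt_of_blocks {d C N₀ : ℕ} (hO : OrbitBoundAt p d C) (hS : SmallOrbitBlocks) (hL : FewLonelyAt p d N₀) :
    AlmostFewTypesAt p d := by
  intro k
  obtain ⟨K, hK⟩ := hS C k
  exact ⟨K + k * N₀, fun m f hf => almostFew_of_almostFewL (hK m f (hO m f hf)) (hL m f hf)⟩

/-- ★ EC ∧ SOB ∧ FewLonely ⟹ `AlmostFewTypesTwoOdd` (kernel). -/
theorem almostFewTypes_of_expCount_blocks (hE : ExpCountTwoOdd) (hS : SmallOrbitBlocks) (hL : FewLonelyTwoOdd) :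
    AlmostFewTypesTwoOdd := by
  intro p _ hp5
  obtain ⟨C, hC⟩ := hE p hp5
  obtain ⟨N₀, hN⟩ := hL p hp5
  exact almostFewTypesAt_of_blocks (orbitBound_of_expCount hC) hS hN

/-- ★ `closes`-shape junction, Z-FREE form (kernel): Leaf ⟸ EC ∧ SOB ∧ FewLonely ∧ ExactFromAlmost. -/
theorem fewTypes_of_pieces' (hE : ExpCountTwoOdd) (hS : SmallOrbitBlocks) (hL : FewLonelyTwoOdd) (hX : ExactFromAlmostTwoOdd) :
    FewTypesTwoOdd :=
  hX (almostFewTypes_of_expCount_blocks hE hS hL)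

/-- … and on to piece B through the tree: B ⟸ PF ∧ EC ∧ SOB ∧ FewLonely ∧ ExactFromAlmost (kernel). -/
theorem structureLaw_of_pieces' (hPF : FieldCorePerPrime) (hE : ExpCountTwoOdd) (hS : SmallOrbitBlocks) (hL : FewLonelyTwoOdd)
    (hX : ExactFromAlmostTwoOdd) : StructureLawTwoOdd :=
  closes_of_PF hPF (partners_of_fewTypes (fewTypes_of_pieces' hE hS hL hX))

/-- Conversely B implies every piece except the support SOB (kernel): the Z-free carving is EXACT up to a paper-proved support. -/
theorem pieces_of_structureLaw' (hB : StructureLawTwoOdd) :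
    ExpCountTwoOdd ∧ FewLonelyTwoOdd ∧ AlmostFewTypesTwoOdd ∧ ExactFromAlmostTwoOdd :=
  ⟨expCount_of_structureLaw hB, fewLonely_of_fewTypes (fewTypes_of_structureLaw hB),
    almostFewTypes_of_fewTypes (fewTypes_of_structureLaw hB), fun _ => fewTypes_of_structureLaw hB⟩

/-- THE LONELY SET HAS DENSITY ZERO given almost-few-types (kernel): off `E` the lonely coordinates carry pairwise distinct colours,
distinct from every non-lonely colour class, so `#lonely ≤ #E + K`.  With EC ∧ SOY (LEMMA Z) this is the rung «k·#lonely ≤ m + K'(p,k) ∀k»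
toward `FewLonelyTwoOdd`. -/
def AlmostFewLonelyAt (p : ℕ) [Fact p.Prime] (d : ℕ) : Prop :=
  ∀ k : ℕ, ∃ K : ℕ, ∀ (m : ℕ) (f : (Fin m → Bool) → Bool), HasDegF p f d → k * (univ.filter fun i : Fin m => Lonely f i).card ≤ m + K

/-- Off the exceptional set of an almost-few colouring the lonely coordinates are coloured injectively: `k·#lonely ≤ m + K + k·K`. -/
theorem lonely_card_le_of_almostFew {m : ℕ} {f : (Fin m → Bool) → Bool} {k K : ℕ} (h : AlmostFew f k K) :
    k * (univ.filter fun i : Fin m => Lonely f i).card ≤ m + K + k * K := by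
  obtain ⟨E, hE, c, hc⟩ := h
  -- lonely coordinates off E are coloured injectively
  have hinj : Set.InjOn c ↑((univ.filter fun i : Fin m => Lonely f i) \ E) := by
    intro i hi j hj hij
    rw [Finset.coe_sdiff, Set.mem_sdiff, Finset.mem_coe, Finset.mem_coe, mem_filter] at hi hj
    by_contra hne
    exact hi.1.2 j (Ne.symm hne) (hc i hi.2 j hj.2 hij)
  have h1 : ((univ.filter fun i : Fin m => Lonely f i) \ E).card ≤ K := by
    have := Finset.card_le_card_of_injOn c (fun i _ => mem_univ (c i)) hinj
    simpa using this
  have h2 : (univ.filter fun i : Fin m => Lonely f i).card ≤ ((univ.filter fun i : Fin m => Lonely f i) \ E).card + E.card := by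
    have := card_le_card_sdiff_add_card (s := univ.filter fun i : Fin m => Lonely f i) (t := E)
    exact this
  have h3 : k * (univ.filter fun i : Fin m => Lonely f i).card ≤ k * K + k * E.card := by
    calc k * (univ.filter fun i : Fin m => Lonely f i).card ≤ k * (((univ.filter fun i : Fin m => Lonely f i) \ E).card + E.card) :=
          Nat.mul_le_mul_left _ h2
      _ = k * ((univ.filter fun i : Fin m => Lonely f i) \ E).card + k * E.card := by ring
      _ ≤ k * K + k * E.card := by have := Nat.mul_le_mul_left k h1; omega
  omega

/-- ★ Almost-few-types ⟹ the lonely set has density zero (kernel). -/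
theorem almostFewLonelyAt_of_almostFewTypesAt {d : ℕ} (h : AlmostFewTypesAt p d) : AlmostFewLonelyAt p d := by
  intro k
  obtain ⟨K, hK⟩ := h k
  exact ⟨K + k * K, fun m f hf => by have := lonely_card_le_of_almostFew (hK m f hf); omega⟩

end Lonely

/-! ### Axiom guards -/

/-- info: 'Summit.QuantumAdvantage.QuantumAdvantage.Theorems.CountDial.fewTypes_of_pieces'' depends on axioms: [propext,
 choice,
 Quot.sound] -/
#guard_msgs in #print axioms fewTypes_of_pieces'

/-- info: 'Summit.QuantumAdvantage.QuantumAdvantage.Theorems.CountDial.structureLaw_of_pieces'' depends on axioms: [propext,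
 choice,
 Quot.sound] -/
#guard_msgs in #print axioms structureLaw_of_pieces'

/-- info: 'Summit.QuantumAdvantage.QuantumAdvantage.Theorems.CountDial.pieces_of_structureLaw'' depends on axioms: [propext,
 choice,
 Quot.sound] -/
#guard_msgs in #print axioms pieces_of_structureLaw'

/-- info: 'Summit.QuantumAdvantage.QuantumAdvantage.Theorems.CountDial.almostFewTypes_of_expCount_blocks' depends on axioms: [propext,
 choice,
 Quot.sound] -/
#guard_msgs in #print axioms almostFewTypes_of_expCount_blocks

/-- info: 'Summit.QuantumAdvantage.QuantumAdvantage.Theorems.CountDial.fewLonely_of_fewTypes' depends on axioms: [propext,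
 choice,
 Quot.sound] -/
#guard_msgs in #print axioms fewLonely_of_fewTypes

/-- info: 'Summit.QuantumAdvantage.QuantumAdvantage.Theorems.CountDial.almostFewLonelyAt_of_almostFewTypesAt' depends on axioms: [propext,
 choice,
 Quot.sound] -/
#guard_msgs in #print axioms almostFewLonelyAt_of_almostFewTypesAt

/-- info: 'Summit.QuantumAdvantage.QuantumAdvantage.Theorems.CountDial.smallOrbitBlocks_of_smallOrbitYoung' depends on axioms: [propext,
 choice,
 Quot.sound] -/
#guard_msgs in #print axioms smallOrbitBlocks_of_smallOrbitYoung

end Summit.QuantumAdvantage.QuantumAdvantage.Theorems.CountDial
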